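import Mathlib
import HarnessLib
import Summits.Langlands.Langlands.Theses.RamifiedCoefficientSeed
import Literature.NumberTheory.Automorphic.ACCAutomorphyLiftingCrystalline
import Literature.NumberTheory.GaloisRepresentations.ResidualRepOfTraceCongruence
import Summits.Langlands.Langlands.Theorems.RamifiedCoefficientSeedAdjointLiftingGL3StubAutomorphyLifting
import Summits.Langlands.Langlands.Theorems.RamifiedCoefficientSeedAdjointLiftingGL3StubUntwist
import Summits.Langlands.Langlands.Theorems.RamifiedCoefficientSeedAdjointLiftingGL3StubAdjointResidualImage
import Summits.Langlands.Langlands.Theorems.RamifiedCoefficientSeedAdjointLiftingGL3BirthDefs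
import Summits.Langlands.Langlands.Theorems.RamifiedCoefficientSeedAdjointLiftingGL3BirthDefs2
import Summits.Langlands.Langlands.Theorems.RamifiedCoefficientSeedAdjointLiftingGL3BirthDefs3
import Summits.Langlands.Langlands.Theorems.RamifiedCoefficientSeedAdjointLiftingGL3BirthDefs4
import Summits.Langlands.Langlands.Theorems.RamifiedCoefficientSeedAdjointLiftingGL3StubLocalShapeGlue
import Summits.Langlands.Langlands.Theorems.RamifiedCoefficientSeedAdjointLiftingGL3StubInertiaOrderTeich
import Summits.Langlands.Langlands.Theorems.RamifiedCoefficientSeedAdjointLiftingGL3StubEnormousAd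
import Summits.Langlands.Langlands.Theorems.RamifiedCoefficientSeedAdjointLiftingGL3StubGaloisSeed
import Summits.Langlands.Langlands.Theorems.RamifiedCoefficientSeedAdjointLiftingGL3StubWeightTwoNewform
import Summits.Langlands.Langlands.Theorems.RamifiedCoefficientSeedAdjointLiftingGL3StubLocalShapeWild
import Summits.Langlands.Langlands.Theorems.RamifiedCoefficientSeedAdjointLiftingGL3StubLocalInertialType
import Summits.Langlands.Langlands.Theorems.RamifiedCoefficientSeedAdjointLiftingGL3StubResidualAdjointForm
import Summits.Langlands.Langlands.Theorems.RamifiedCoefficientSeedAdjointLiftingGL3StubBigImageScalar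
import Literature.NumberTheory.Automorphic.GelbartJacquetAdjointLiftArchimedean
import Summits.Langlands.Langlands.Theorems.RamifiedCoefficientSeedAdjointLiftingGL3StubAutomorphicSeed

/-!
# Birth skeleton (BC3) for crux stmt-Langlands-16779
`Summit.Langlands.Langlands.Theses.RamifiedCoefficientSeed.AdjointLiftingGL3` — line `birth`

THE CRUX: `p ≥ 11`; `ρ : Γ_ℚ → GL₃(ℚ̄_p)` unramified a.e., crystalline at `p` with labelled
Hodge–Tate weights `{0,1,2}` (Fontaine's pinned datum), `ρ̄|_{Γ_{ℚ(ζ_p)}}` absolutely irreducible,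
and `tr ρ ≡ η · (tr(ρ₀)²/det ρ₀ − 1) (mod 𝔪)` for some ODD `ρ₀ : Γ_ℚ → GL₂(ℚ̄_p)` and a character
`η` ⟹ for every `ι : ℚ̄_p ≃ ℂ` and `hcpt` a cuspidal L-algebraic `π` of `GL₃(𝔸_ℚ)` Satake–Frobenius
compatible with `ρ` at almost all places.  The engine is ACC+ Thm. 6.1.1 (vendored, weight `0`, as
the named fact `ACCGHLNSTT2023.automorphyLifting_crystalline_weightZero`), fed by lemmas that
manufacture its hypotheses (card `Lines/birth.md`).

## Skeleton history (line lead `prover-line-stmt-Langlands-16779-0`, 2026-08-17)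

* v1 (planner-skel): stubs B (residual image package), C (same-weight seed), A (ACC+ 6.1.1 at
  `F = ℚ`, `n = 3`), D (`|det|⁻¹` untwist).  v2: `HLTT.IsCompatible` rename, fact-stub for the
  vendored fact.  v3: A LANDED (p159087), D LANDED (p158681), B's glue LANDED (p160425, p159870:
  B from its IMAGE CORE), `of_trace_congr` LANDED (p160888); open B-core + C (trace-congruence form).
* **v4 — the fine split**, over the interface vocabulary of
  `Theorems/RamifiedCoefficientSeedAdjointLiftingGL3BirthDefs2.lean` (p164420; the interface `Prop`s):
  - `stub_residualAdjointForm` (S1): the residual dictionary `τ ≅ η̄ ⊗ ad⁰(τ₀)` in the fixed frame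
    (`IsTwistedAdZero`), for every absolutely irreducible residual `τ` of `ρ`, from the seed
    congruence alone (`p ≥ 5`): trace congruence ⇒ `τ` is a residual representation of the `p`-adic
    `η ⊗ ad⁰ ρ₀` (`FramedRep.adZeroTwoTwist`, `charpoly_adZeroTwoTwist`, `of_trace_congr`), whose
    natural reduction is irreducible, hence conjugate to `τ`; plus finiteness of `τ₀(Γ_ℚ)` and the
    transfer of absolute irreducibility to `ad⁰ τ₀`.
  - `stub_localFL` (S2, the LEAD's): the LOCAL analysis at `p` — Fontaine–Laffaille on
    `ρ̄|_{Γ_{ℚ_p}} ≅ η̄ ⊗ ad⁰(τ₀|_{Γ_{ℚ_p}})` with weights `{0,1,2}`: (a) a projective inertia element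
    of `τ₀` of order `p − 1`, `p` or `p + 1 > 5`; (b) `η̄|_{I_p} = ω⁻¹`, so the Teichmüller lift `μ` of
    `η̄ ω̄` is a finite-order character unramified at `p` with `μ ≡ η ε_p`; (c) Serre weight
    `k(τ₀ ⊗ ω̄^{-s}) = 2` (tree: `serreWeight_eq_two_of_shape`), hence, by Khare–Wintenberger (named
    fact `khare_wintenberger`, hypothesis), a newform `g ∈ S₂(Γ₁(M))`, `p ∤ M`, with
    `σ̄ = ω̄^s ⊗ τ₀` attached (`WeightTwoNewformFor`).  Needs the Fontaine–Laffaille CLAUSE for the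
    pinned datum (to be added to `IsFontaineDatum`, upgrade path of `FontaineDpst`) — until then this
    stub is the line's known open front.
  - `stub_bigImageScalar` (S3): Dickson (accepted `PGL2.pslTwo_le_conj_le_pglTwo_of_five_le`):
    `ad⁰ τ₀` absolutely irreducible on `Γ_{ℚ(ζ_p)}` (no fixed point, no stable pair) + an element of
    projective order `> 5` ⇒ `PSL₂(𝔽) ≤ proj τ₀(Γ_{ℚ(ζ_p)}) ≤ PGL₂(𝔽)` up to conjugacy
    (`BigProjImageOnCyclotomic`; the commutator step `[PH, PH] ⊇ PSL₂(𝔽)` passes from `Γ_ℚ` to the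
    normal subgroup `Γ_{ℚ(ζ_p)}` with cyclic quotient), and a SCALAR `τ σ`, `σ ∉ Γ_{ℚ(ζ_p)}`, for every
    `τ ≅ η̄ ⊗ ad⁰ τ₀` (the abelianisation of the projective image has order `≤ 2 < p − 1`).
  - `stub_enormousAd` (S4): ACC+ Lemma 7.1.5 (`lemen`: `l > 2n+1`, `H ⊇ SL₂(𝔽_l)` finite ⇒
    `Sym^{n-1} H` enormous; named fact to vendor, `n = 3`) + "enormous depends only on the projective
    image" (Def. 6.2.28, remark) + `ad⁰ = Sym² ⊗ det⁻¹` in the two frames ⇒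
    `τ(Γ_{ℚ(ζ_p)})` enormous.
  - `stub_automorphicSeed` (S5): `AutomorphicAdjointSeed p` — `π₀ = Ad(π_g) ⊗ χ` cuspidal of weight
    zero, Satake `χ(ϖ_v)·Ad(t_{π,v})` above `p` and a.e. (Gelbart–Jacquet Thm. (9.3) (2)–(3), (3.5),
    Prop. (3.2): the pointwise/archimedean form to vendor; Borel–Jacquet twists).
  - `stub_galoisSeed` (S6): from `TeichTwistFor`, `WeightTwoNewformFor` (∀ `k`), S5's statement and
    HLTT Thm. A (existence + uniqueness, named facts, hypotheses): the cuspidal `π` of `g`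
    (`exists_cuspidalAutomorphicRepData_newform`), no quadratic self-twist (else `ad⁰ σ̄` reducible,
    Chebotarev), `π₀` from S5 with the Hecke character of `μ` (class field theory), `r := r_ι(π₀)`;
    `tr r = μ ε⁻¹ (tr ρ_g²/det ρ_g − 1)` (uniqueness against `μ ε⁻¹ ⊗ ad⁰ ρ_{g,ι}`), `≡ η (tr ρ₀²/det
    ρ₀ − 1) ≡ tr ρ (mod 𝔪)`: `WeightZeroSeedFor p ρ ι hcpt`.
  - fact-stub `stub_namedFacts`: the conjunction of the NAMED FACTS the line is conditional on —
    ACC+ 6.1.1 (vendored), Khare–Wintenberger (`khare_wintenberger`, ∀ `p k`), HLTT Thm. A existence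
    and uniqueness (`HarrisLanTaylorThorne2016.theoremA_existence/_uniqueness`).  NEVER a work target;
    the closing theorem takes these as hypotheses.

* **v5 (this file) — after wave 2.**  S1 `stub_residualAdjointForm` LANDED (p165429, helpers
  p165046 p165075) and S3 `stub_bigImageScalar` LANDED (p165239, helpers p164821): imported and
  CALLED.  S5: the POINTWISE Gelbart–Jacquet theorem was vendored (named fact
  `GelbartJacquet_adjoint_lift_pointwise`, p165033) and S5 is now the conditional
  `stub_automorphicSeed : GelbartJacquet_adjoint_lift_pointwise → ∀ p, AutomorphicAdjointSeed p`
  — PROVED as `automorphicSeed_of_GJ` (p165034, LANDED) and CALLED by the composition.  S6 RESHAPED after the worker's verdict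
  `stub-misstated`: the weight-two newform must be ALIGNED with `ι` (`WeightTwoNewformAlong`,
  `…BirthDefs3.lean`), so the aligned hypothesis now comes AFTER `∀ ι`; three S6 helper files landed
  (p164418 Frobenius propagation + `arithFrobPolyOfSatake_three_adParams`; p165025 no quadratic
  self-twist from `ad⁰` absolutely irreducible; p165258 residual trace congruences).  S2 SPLIT into
  S2a `stub_localShape` (the lead's: Fontaine–Laffaille at the pinned datum ⇒ `LocalShapeAt`, under
  `FontaineDatumExists` once clause (F13) `FontaineLaffailleReductions` — predicate file accepted
  p165182 — is a field of `IsFontaineDatum`), S2b `stub_inertiaOrderTeich` (`LocalShapeAt` ⇒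
  projective inertia element of order `> 5` + the Teichmüller twist `μ`) and S2c
  `stub_weightTwoNewform` (`LocalShapeAt` + odd + KW ⇒ the ALIGNED weight-two newform for every `ι`:
  Serre weight `2` by `serreWeight_eq_two_of_shape`, KW, `not_dvd_serreLevel`, alignment by the
  landed residue-adapted embedding / conjugate-newform stubs of crux `SerreKWAutomorphicGL2`).  The
  fact-stub now also carries `GelbartJacquet_adjoint_lift_pointwise` and `FontaineDatumExists`.

SKELETON v10 (2026-08-17 ~20:00Z): CORE-A `stub_localInertialType` LANDED (wave-4 worker) and is called — EVERY stub of the line is closed; the only `sorry` left is the fact-stub `stub_namedFacts` (seven vendored published theorems F1–F7): the composition is the crux modulo F1–F7, landed in frame form as `Summit.Langlands.Langlands.Theorems.AdjointLiftingGL3_of_namedFacts`. SKELETON v9 (2026-08-17 19:05Z): CORE-B `stub_localShapeWild` LANDED (p169158, lead) and is called; open: CORE-A `stub_localInertialType` + the named facts. SKELETON v8 (2026-08-17 18:40Z): S2c `stub_weightTwoNewform` (p168716) and S6 `stub_galoisSeed` (p168659) LANDED and are called; open: CORE-A, CORE-B (proved, landing), named facts. SKELETON v7 (2026-08-17 17:15Z):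 S2b `stub_inertiaOrderTeich` LANDED (p168197, wave 3) and is called; S4 LANDED conditionally as `enormousAd_of_facts` (p167094) on the vendored ACC+ Lemma 7.1.5 (`ACC_symmSq_enormous_of_specialLinearGroup_le`, p167093), now a conjunct of `stub_namedFacts`. SKELETON v6 (2026-08-17 16:50Z): S2a is reduced to its LOCAL core by the landed glue `stub_localShape_of_core` (p168017) and split into CORE-A `stub_localInertialType` / CORE-B `stub_localShapeWild` (vocabulary `…BirthDefs4`, p167755).

Composition `AdjointLiftingGL3_of` (kernel-checked, no `sorry` outside the `stub_*`): for each
absolutely irreducible residual `τ` (landed glue `adjointResidualImage_of_imageCore`): landed S1 →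
S2a,S2b → landed S3 → S4 give enormous + scalar; S2a → S2b (μ), S2c (aligned newform) → S6 (fed the landed S5
and the facts) give the weight-zero seed; `of_trace_congr`; landed A (fed ACC+); landed D.

Disproof used: `Cruxes/AdjointLiftingGL3/Disproof.lean` (cdisprove cycle 1): NO KILL; the landed
`adjointLiftingGL3_false_without_residualIrreducibility` (Eisenstein witness) makes residual
irreducibility over `ℚ(ζ_p)` load-bearing — it is the input of S1/S3 (absolute irreducibility of
`ad⁰ τ₀`) and of the landed glue.
-/

set_option linter.dupNamespace false

noncomputable section

namespace Summit.Langlands.Langlands.Cruxes.AdjointLiftingGL3.Birth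

open Summit.Langlands.Langlands.Theses.RamifiedCoefficientSeed
open scoped MatrixGroups NumberField
open NumberField IsDedekindDomain Field Filter
open Literature.NumberTheory.GaloisRepresentations Literature.NumberTheory.PAdicHodge
open Literature.NumberTheory.Automorphic
open Literature.NumberTheory.GaloisRepresentations.IsNonarchimedeanLocalField

/-! ## 1. The open stubs -/

/-- **S2a — the local shape at `p`, PROVED from the two local halves** (landed glue
`stub_localShape_of_core`, p168017: the pinned (F13) clause of `ℚ_v` applied to `ρ|_{Γ_{ℚ_v}}` and
its absolutely irreducible reduction `η̄ ⊗ ad⁰ τ₀` (landed S1), transferred to every residual `τ₀'`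
and reduction `η̄'`). [cite: FontaineLaffaille1982, Thm. 5.3 (iii)] [cite: GeeHerzigLiuSavitt2017, Prop. 2.3.1] -/
theorem localShape_of_stubs :
    ∀ (p : ℕ) [Fact p.Prime], 11 ≤ p →
      ∀ (ρ : FramedGaloisRep ℚ (PadicAlgCl p) 3) (ρ₀ : FramedGaloisRep ℚ (PadicAlgCl p) 2)
        (η : FramedGaloisRep ℚ (PadicAlgCl p) 1), CrysHT012 p ρ →
        (ρ.restrictField (CyclotomicField p ℚ)).IsResiduallyAbsIrreducible → AdjointSeed p ρ ρ₀ η →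
        FontaineDatumExists → LocalShapeAt p ρ₀ η :=
  stub_localShape_of_core (fun p _ hp K _ _ _ _ hq V χ T hV hχ hT ι ϖ hϖ hFL =>
    ⟨(stub_localInertialType p hp K hq V χ T hV hχ hT ι ϖ hϖ hFL).1,
     (stub_localInertialType p hp K hq V χ T hV hχ hT ι ϖ hϖ hFL).2.elim id
       (stub_localShapeWild p hp K hq V χ T hV hχ hT ι ϖ hϖ hFL
         (stub_localInertialType p hp K hq V χ T hV hχ hT ι ϖ hϖ hFL).1)⟩)

/-- **Fact-stub — the NAMED FACTS the line is conditional on** (never a work target; registered as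
a stub only because the composition's hypotheses must be registered stubs; the closing theorem takes
them as hypotheses): ACC+ Thm. 6.1.1 weight zero (vendored `automorphyLifting_crystalline_weightZero`,
p126480), Khare–Wintenberger (`khare_wintenberger`, for every `p` and coefficient field),
Harris–Lan–Taylor–Thorne Thm. A existence and uniqueness (`theoremA_existence`, `theoremA_uniqueness`),
Gelbart–Jacquet Thm. (9.3) pointwise (`GelbartJacquet_adjoint_lift_pointwise`, p165033), Fontaine's
construction of the pinned `p`-adic Hodge datum (`FontaineDatumExists`, T0 fact of the summit), ACC+
Lemma 7.1.5 for `n = 3` (`ACC_symmSq_enormous_of_specialLinearGroup_le`, p167093; consumed by the landed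
conditional S4 `enormousAd_of_facts`, p167094).
[cite: ACCGHLNSTT2023, Thm. 6.1.1] [cite: KhareWintenberger2009, Thm. 1.2]
[cite: HarrisLanTaylorThorneRMS2016, Thm. A] [cite: GelbartJacquet1978, Thm. (9.3)]
[cite: FontaineAsterisque223VIII, §2.3.7] [cite: ACCGHLNSTT2023, Lemma 7.1.5] -/
theorem stub_namedFacts :
    ACCGHLNSTT2023.automorphyLifting_crystalline_weightZero ∧
      (∀ (p : ℕ) [Fact p.Prime] (k : Type) [Field k] [TopologicalSpace k] [DiscreteTopology k],
        khare_wintenberger p k) ∧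
      HarrisLanTaylorThorne2016.theoremA_existence ∧ HarrisLanTaylorThorne2016.theoremA_uniqueness ∧
      GelbartJacquet_adjoint_lift_pointwise ∧ FontaineDatumExists ∧
      ACC_symmSq_enormous_of_specialLinearGroup_le := by
  sorry

/-! ## 2. The stub statements as named propositions (the composition's hypotheses, by name) -/

namespace _Goal

/-- The statement of `stub_namedFacts`, as a named `Prop`. [folklore] -/
def stub_namedFacts : Prop :=
  type_of% @Summit.Langlands.Langlands.Cruxes.AdjointLiftingGL3.Birth.stub_namedFacts

end _Goal

/-! ## 3. The composition (kernel-checked, no `sorry`): image + seed + lifting + untwist → crux -/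

/-- **`AdjointLiftingGL3` from the open stubs, the landed ones and the named facts.**  For every
absolutely irreducible residual `τ` of `ρ` (the landed glue `adjointResidualImage_of_imageCore` asks
for enormous + scalar on those): landed S1 writes `τ = P(η̄ · Ad τ₀)P⁻¹`; S2a (local shape) with
S2b gives an element of projective order `> 5`; landed S3 (Dickson) gives the big projective image on
`Γ_{ℚ(ζ_p)}` and the scalar element; S4 (ACC+ §7.1) gives enormous.  S2b gives the Teichmüller twist,
S2c the aligned weight-two newform (under Khare–Wintenberger), S6 (fed S5 under pointwise
Gelbart–Jacquet, and HLTT Thm. A) the weight-zero seed congruent to `ρ`; `of_trace_congr` matches it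
with `τ`; the landed ACC+ stub lifts and the landed untwist stub concludes. [folklore] -/
theorem AdjointLiftingGL3_of (hF : _Goal.stub_namedFacts) :
    Summit.Langlands.Langlands.Theses.RamifiedCoefficientSeed.AdjointLiftingGL3 := by
  unfold _Goal.stub_namedFacts at hF
  intro p _ hp ρ hunr hcrys hirr hseed ι hcpt
  have hp5 : 5 ≤ p := le_trans (by norm_num) hp
  obtain ⟨ρ₀, η, hodd, hcong⟩ := hseed
  obtain ⟨hACC, hKW, hAex, hAun, hGJ, hFDE, hLem⟩ := hF
  -- the local shape at `p` (S2a) and its two consequences (S2b)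
  have hshape : LocalShapeAt p ρ₀ η :=
    stub_localShape_of_core (fun p _ hp K _ _ _ _ hq V χ T hV hχ hT ι ϖ hϖ hFL =>
      ⟨(stub_localInertialType p hp K hq V χ T hV hχ hT ι ϖ hϖ hFL).1,
       (stub_localInertialType p hp K hq V χ T hV hχ hT ι ϖ hϖ hFL).2.elim id
         (stub_localShapeWild p hp K hq V χ T hV hχ hT ι ϖ hϖ hFL
           (stub_localInertialType p hp K hq V χ T hV hχ hT ι ϖ hϖ hFL).1)⟩)
      p hp ρ ρ₀ η hcrys hirr hcong hFDE
  obtain ⟨hord, ⟨μ, hμ⟩⟩ := stub_inertiaOrderTeich p hp ρ₀ η hshape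
  -- the image core, for every absolutely irreducible residual `τ` of `ρ`
  have hcore : ∀ τ : absoluteGaloisGroup ℚ →* GL (Fin 3) (padicAlgClResidueField p),
      ρ.IsResidualRepOf (RingHom.id _) τ →
        IsAbsIrreducible (τ.comp (absGaloisGroupAdjoinRootsOfUnity ℚ p).subtype) →
          Subgroup.IsEnormous ((absGaloisGroupAdjoinRootsOfUnity ℚ p).map τ) ∧
            ScalarOffCyclotomic p τ := by
    intro τ hτ habsζ
    have habs : IsAbsIrreducible τ :=
      (isAbsIrreducible_of_isResidualRepOf_of_restrictField ρ hirr hτ).2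
    obtain ⟨τ₀, ηb, hτ₀, -, hfin, hform, -, hirrH⟩ :=
      stub_residualAdjointForm p hp5 ρ ρ₀ η hcong τ hτ habs
    obtain ⟨hbig, hscal⟩ := stub_bigImageScalar p hp τ₀ hfin (hirrH _ habsζ) (hord τ₀ hτ₀)
    exact ⟨enormousAd_of_facts hLem p hp τ₀ hfin τ ηb hform hbig, hscal τ ηb hform⟩
  obtain ⟨τ, hτ, habs, hdg, habsζ, henorm, hscalar⟩ :=
    adjointResidualImage_of_imageCore p ρ hirr hcore
  -- `ad⁰ τ₀` is absolutely irreducible for some residual `τ₀` of `ρ₀` (landed S1 at this `τ`)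
  have had : ∃ τ₀ : absoluteGaloisGroup ℚ →* GL (Fin 2) (padicAlgClResidueField p),
      ρ₀.IsResidualRepOf (RingHom.id _) τ₀ ∧ IsAbsIrreducible (adZeroOf τ₀) := by
    obtain ⟨τ₀, ηb, hτ₀, -, -, -, had, -⟩ := stub_residualAdjointForm p hp5 ρ ρ₀ η hcong τ hτ habs
    exact ⟨τ₀, hτ₀, had⟩
  -- the aligned weight-two newform (S2c) and the weight-zero seed congruent to `ρ` (S6)
  obtain ⟨π₀, r, hw0, hunrp, hcompat, hcongr⟩ :=
    stub_galoisSeed p hp ρ ρ₀ η hirr hodd hcong had μ hμ (automorphicSeed_of_GJ hGJ p) hAex hAun ι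
      (fun k _ _ _ _ _ ιk =>
        stub_weightTwoNewform p hp ρ₀ η hodd had hshape (fun k _ _ _ => hKW p k) ι k ιk) hcpt
  -- `τ` is a residual representation of `r` (trace congruence, rank 3, `p ≥ 5`)
  have hr : r.IsResidualRepOf (RingHom.id _) τ :=
    FramedGaloisRep.IsResidualRepOf.of_trace_congr hp5 ρ r hcongr hτ
  -- automorphy lifting (landed STUB A = ACC+ Thm. 6.1.1 at `F = ℚ`, `n = 3`, weight zero)
  obtain ⟨Pi, hPiw, hPic⟩ :=
    stub_automorphyLifting hACC p hp hcpt ι ρ τ π₀ r hunr hcrys hτ habs hdg habsζ henorm hscalar hw0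
      hcompat hr hunrp
  -- untwist HLTT's normalisation to the summit's L-algebraic Satake–Frobenius matching (landed D)
  exact stub_untwist p hcpt ι ρ Pi hPiw hPic

/-- By-name sanity check (an `example`, not a declaration of the file): the open stubs feed the
composition as they stand. -/
example : Summit.Langlands.Langlands.Theses.RamifiedCoefficientSeed.AdjointLiftingGL3 :=
  AdjointLiftingGL3_of stub_namedFacts

end Summit.Langlands.Langlands.Cruxes.AdjointLiftingGL3.Birth

end
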